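import Mathlib

/-!
# Weight gradings on polynomial rings: the degree-`0` part (generic bookkeeping for the V3U/V4U root charts)

(crux stmt-ResolutionOfSingularities-15640 `WildQuotients.WildQuotientResolution`, line `Sketch`,
sector `|G| = p`; programmes V3U/V4U of `L/w45c/CHAIN.md` v5 (root charts of weighted blow-ups:
the chart ring is the weight-`0` part of a `ZMod m`-grading of the root polynomial ring — `μ₂` for
`J₃`, `μ₃`/`μ₂` for `J₄`); [OURS · L1 W4.5c] — NOT a statement of any manuscript; replaces the role
of no printed item. Route-independent: `import Mathlib` only; generic in the weight monoid `M`.)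

For a weight `w : σ → M` (`M` any additive commutative monoid, e.g. `ZMod m`) on `R[xᵢ : i ∈ σ]`:
* `isWeightedHomogeneous_zero_of_mem_adjoin` — a subalgebra generated by weight-`0` homogeneous
  elements consists of weight-`0` homogeneous elements (`Algebra.adjoin_induction`);
* `mem_adjoin_monomial_of_isWeightedHomogeneous_zero` — conversely every weight-`0` homogeneous
  polynomial lies in the subalgebra generated by the weight-`0` MONOMIALS `monomial d 1`,
  `weight w d = 0` (indeed in their `R`-span);
* `mem_adjoin_iff_isWeightedHomogeneous_zero` — hence `Algebra.adjoin R G` IS the weight-`0`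
  part as soon as `G` is weight-`0` homogeneous and generates every weight-`0` monomial.
So «chart subring = weight-`0` part» reduces, chart by chart, to «the listed chart generators
generate all weight-`0` monomials» — a finite combinatorial statement (V6).
-/

-- single-problem summit: the doubled namespace component `ResolutionOfSingularities` is forced
set_option linter.dupNamespace false

noncomputable section

open MvPolynomial

namespace Summit.ResolutionOfSingularities.ResolutionOfSingularities.Theorems.WildQuotientResolution.ToricExit

variable {σ R M : Type*} [CommRing R] [AddCommMonoid M] (w : σ → M)

/-- **A subalgebra generated by weight-`0` homogeneous elements is weight-`0` homogeneous.**
[folklore] -/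
theorem isWeightedHomogeneous_zero_of_mem_adjoin (G : Set (MvPolynomial σ R))
    (hG : ∀ g ∈ G, IsWeightedHomogeneous w g 0) (f : MvPolynomial σ R)
    (hf : f ∈ Algebra.adjoin R G) : IsWeightedHomogeneous w f 0 := by
  induction hf using Algebra.adjoin_induction with
  | mem g hg => exact hG g hg
  | algebraMap r => exact isWeightedHomogeneous_C w r
  | add x y _ _ hx hy => exact hx.add hy
  | mul x y _ _ hx hy =>
    have h := hx.mul hy
    rwa [add_zero] at h

/-- **Weight-`0` homogeneous polynomials are generated by the weight-`0` monomials** (indeed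
`R`-spanned: `f = ∑_d coeff_d f · x^d` over its support, all of weight `0`). [folklore] -/
theorem mem_adjoin_monomial_of_isWeightedHomogeneous_zero (f : MvPolynomial σ R)
    (hf : IsWeightedHomogeneous w f 0) :
    f ∈ Algebra.adjoin R {g : MvPolynomial σ R | ∃ d : σ →₀ ℕ, Finsupp.weight w d = 0 ∧
      g = monomial d 1} := by
  classical
  rw [f.as_sum]
  refine Subalgebra.sum_mem _ fun d hd => ?_
  have hwd : Finsupp.weight w d = 0 := hf (mem_support_iff.mp hd)
  have e : monomial d (coeff d f) = C (coeff d f) * monomial d 1 := by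
    rw [C_mul_monomial, mul_one]
  rw [e]
  exact Subalgebra.mul_mem _ (Subalgebra.algebraMap_mem _ _)
    (Algebra.subset_adjoin ⟨d, hwd, rfl⟩)

/-- **The weight-`0` part equals the subalgebra generated by the weight-`0` monomials.**
[folklore] -/
theorem isWeightedHomogeneous_zero_iff_mem_adjoin_monomial (f : MvPolynomial σ R) :
    IsWeightedHomogeneous w f 0 ↔
      f ∈ Algebra.adjoin R {g : MvPolynomial σ R | ∃ d : σ →₀ ℕ, Finsupp.weight w d = 0 ∧
        g = monomial d 1} := by
  refine ⟨mem_adjoin_monomial_of_isWeightedHomogeneous_zero w f, fun hf => ?_⟩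
  refine isWeightedHomogeneous_zero_of_mem_adjoin w _ ?_ f hf
  rintro _ ⟨d, hd, rfl⟩
  exact isWeightedHomogeneous_monomial w d 1 hd

/-- **Reduction of «chart subring = weight-0 part» to monomial generation**: if every weight-`0`
monomial lies in `Algebra.adjoin R G` and `G` consists of weight-`0` homogeneous elements, then
`Algebra.adjoin R G` is exactly the weight-`0` part. [folklore] -/
theorem mem_adjoin_iff_isWeightedHomogeneous_zero (G : Set (MvPolynomial σ R))
    (hG : ∀ g ∈ G, IsWeightedHomogeneous w g 0)
    (hmon : ∀ d : σ →₀ ℕ, Finsupp.weight w d = 0 → (monomial d (1 : R)) ∈ Algebra.adjoin R G)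
    (f : MvPolynomial σ R) :
    f ∈ Algebra.adjoin R G ↔ IsWeightedHomogeneous w f 0 := by
  refine ⟨isWeightedHomogeneous_zero_of_mem_adjoin w G hG f, fun hf => ?_⟩
  have h := mem_adjoin_monomial_of_isWeightedHomogeneous_zero w f hf
  have hle : Algebra.adjoin R {g : MvPolynomial σ R | ∃ d : σ →₀ ℕ, Finsupp.weight w d = 0 ∧
      g = monomial d 1} ≤ Algebra.adjoin R G := by
    refine Algebra.adjoin_le ?_
    rintro _ ⟨d, hd, rfl⟩
    exact hmon d hd
  exact hle h

end Summit.ResolutionOfSingularities.ResolutionOfSingularities.Theorems.WildQuotientResolution.ToricExit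

end
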